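import Mathlib.LinearAlgebra.Matrix.SpecialLinearGroup
import Mathlib.LinearAlgebra.UnitaryGroup
import Mathlib.Analysis.Complex.Basic
import Mathlib.RingTheory.MvPolynomial.Homogeneous
import Literature.Computability.AlgebraicComplexity.LinSubst
import HarnessLib

/-!
# The `n`-fold tensor power action of square matrices and its polynomial shadow

Support file for the proof of Bürgisser–Ikenmeyer 2017, Cor. 2.9 (`det_n` and `per_n` are
polystable, `Polystability.lean`), Kempf–Ness part. For a finite index type `σ` and `n : ℕ` an
`n`-tensor over `σ` is a function `T : (Fin n → σ) → R`; a square matrix `A : Matrix σ σ R` acts by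
its `n`-th tensor power

  `(A • T) j = ∑ i, (∏ k, A (j k) (i k)) * T i`            (`tensorAct A T`),

and the *polynomial shadow* of a tensor is `tensorToPoly T = ∑ j, T j · ∏ k, X (j k)`, a form of
degree `n` in the variables `σ`. The two are compatible with the tree's linear substitution action
`linSubst` (`LinSubst.lean`, `X i ↦ ∑ j, A j i • X j`):
`tensorToPoly (tensorAct A T) = linSubst σ R A (tensorToPoly T)` (`tensorToPoly_tensorAct`).
Over `ℂ` the squared norm `tnormSq T = ∑ j, ‖T j‖ ^ 2` is invariant under unitary matrices
(`tnormSq_tensorAct_of_conjTranspose_mul_self`), and diagonal matrices act diagonally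
(`tensorAct_diagonal`). Everything here is elementary multilinear algebra (Kempf–Ness 1979, §1,
set-up; Landsberg 2017, §2.1) and fully proved. [folklore]

## Design

* Tensors are plain functions `(Fin n → σ) → R` (no `PiTensorProduct`): the action, the norm and
  the passage to `MvPolynomial` are then finite sums handled by `Fintype.prod_sum`.
* The convention `∏ k, A (j k) (i k)` (row index = output slot) is the one making `tensorToPoly`
  equivariant for `linSubst` and `tensorAct` a *left* action (`tensorAct_mul`).

## References

* G. Kempf, L. Ness, *The length of vectors in representation spaces*, LNM 732 (1979), §1.
* J. M. Landsberg, *Geometry and Complexity Theory*, CUP (2017), §2.1 (tensor and polynomial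
  actions of `GL`).
-/

noncomputable section

open MvPolynomial Finset
open scoped Matrix

namespace Literature.Computability.AlgebraicComplexity

section Action

variable {σ : Type*} [Fintype σ] {R : Type*} [CommRing R] {n : ℕ}

/-- The `n`-th tensor power action of a square matrix `A` on `n`-tensors `T : (Fin n → σ) → R`:
`(A • T) j = ∑ i, (∏ k, A (j k) (i k)) * T i`. Landsberg 2017 §2.1. [folklore] -/
def tensorAct (A : Matrix σ σ R) (T : (Fin n → σ) → R) : (Fin n → σ) → R :=
  fun j => ∑ i : Fin n → σ, (∏ k, A (j k) (i k)) * T i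

/-- Unfolding `tensorAct`. [folklore] -/
theorem tensorAct_apply (A : Matrix σ σ R) (T : (Fin n → σ) → R) (j : Fin n → σ) :
    tensorAct A T j = ∑ i : Fin n → σ, (∏ k, A (j k) (i k)) * T i := rfl

/-- The identity matrix acts trivially. [folklore] -/
@[simp]
theorem tensorAct_one [DecidableEq σ] (T : (Fin n → σ) → R) : tensorAct (1 : Matrix σ σ R) T = T := by
  funext j
  rw [tensorAct_apply]
  have h : ∀ i : Fin n → σ, (∏ k, (1 : Matrix σ σ R) (j k) (i k)) = if i = j then 1 else 0 := by
    intro i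
    simp only [Matrix.one_apply]
    rw [Finset.prod_boole]
    by_cases hij : i = j
    · subst hij; simp
    · rw [if_neg, if_neg hij]
      intro hall
      exact hij (funext fun k => (hall k (Finset.mem_univ k)).symm)
  simp_rw [h]
  simp

/-- `tensorAct` is a left action: `(A * B) • T = A • (B • T)`. [folklore] -/
theorem tensorAct_mul (A B : Matrix σ σ R) (T : (Fin n → σ) → R) :
    tensorAct (A * B) T = tensorAct A (tensorAct B T) := by
  funext j
  simp only [tensorAct_apply, Finset.mul_sum]
  rw [Finset.sum_comm]
  refine Finset.sum_congr rfl fun i _ => ?_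
  have h : (∏ k, (A * B) (j k) (i k)) = ∑ x : Fin n → σ, ∏ k, A (j k) (x k) * B (x k) (i k) := by
    simp only [Matrix.mul_apply]
    exact Fintype.prod_sum (fun k y => A (j k) y * B y (i k))
  rw [h, Finset.sum_mul]
  refine Finset.sum_congr rfl fun x _ => ?_
  rw [Finset.prod_mul_distrib]
  ring

/-- `tensorAct` is additive in the tensor. [folklore] -/
theorem tensorAct_add (A : Matrix σ σ R) (S T : (Fin n → σ) → R) :
    tensorAct A (S + T) = tensorAct A S + tensorAct A T := by
  funext j
  simp only [tensorAct_apply, Pi.add_apply, mul_add, Finset.sum_add_distrib]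

/-- `tensorAct` commutes with scalars in the tensor. [folklore] -/
theorem tensorAct_smul (A : Matrix σ σ R) (c : R) (T : (Fin n → σ) → R) :
    tensorAct A (c • T) = c • tensorAct A T := by
  funext j
  simp only [tensorAct_apply, Pi.smul_apply, smul_eq_mul, Finset.mul_sum]
  refine Finset.sum_congr rfl fun i _ => ?_
  ring

/-- `tensorAct A 0 = 0`. [folklore] -/
@[simp]
theorem tensorAct_zero (A : Matrix σ σ R) : tensorAct A (0 : (Fin n → σ) → R) = 0 := by
  funext j
  simp [tensorAct_apply]

/-- `tensorAct` preserves subtraction. [folklore] -/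
theorem tensorAct_sub (A : Matrix σ σ R) (S T : (Fin n → σ) → R) :
    tensorAct A (S - T) = tensorAct A S - tensorAct A T := by
  funext j
  simp only [tensorAct_apply, Pi.sub_apply, mul_sub, Finset.sum_sub_distrib]

/-- The tensor power action as an `R`-linear map. [folklore] -/
def tensorActLin (A : Matrix σ σ R) : ((Fin n → σ) → R) →ₗ[R] ((Fin n → σ) → R) where
  toFun := tensorAct A
  map_add' := tensorAct_add A
  map_smul' := tensorAct_smul A

/-- Unfolding `tensorActLin`. [folklore] -/
@[simp]
theorem tensorActLin_apply (A : Matrix σ σ R) (T : (Fin n → σ) → R) :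
    tensorActLin A T = tensorAct A T := rfl

/-- A diagonal matrix acts diagonally: `(diag d • T) j = (∏ k, d (j k)) * T j`. [folklore] -/
theorem tensorAct_diagonal [DecidableEq σ] (d : σ → R) (T : (Fin n → σ) → R) :
    tensorAct (Matrix.diagonal d) T = fun j => (∏ k, d (j k)) * T j := by
  funext j
  rw [tensorAct_apply]
  have h : ∀ i : Fin n → σ, (∏ k, Matrix.diagonal d (j k) (i k)) =
      if i = j then ∏ k, d (j k) else 0 := by
    intro i
    by_cases hij : i = j
    · subst hij
      simp [Matrix.diagonal_apply_eq]
    · rw [if_neg hij]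
      have : ∃ k, i k ≠ j k := by
        by_contra hno
        push Not at hno
        exact hij (funext hno)
      obtain ⟨k, hk⟩ := this
      exact Finset.prod_eq_zero (Finset.mem_univ k) (Matrix.diagonal_apply_ne d hk.symm)
  simp_rw [h]
  simp

/-- Scalar matrices: `(c • A) • T = c ^ n • (A • T)`. [folklore] -/
theorem tensorAct_smul_left (c : R) (A : Matrix σ σ R) (T : (Fin n → σ) → R) :
    tensorAct (c • A) T = c ^ n • tensorAct A T := by
  funext j
  simp only [tensorAct_apply, Pi.smul_apply, smul_eq_mul, Matrix.smul_apply, Finset.mul_sum]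
  refine Finset.sum_congr rfl fun i _ => ?_
  rw [Finset.prod_mul_distrib, Finset.prod_const, Finset.card_univ, Fintype.card_fin]
  ring

/-- The entries of `A • T` are polynomial, hence jointly continuous, in `(A, T)` over `ℂ`.
[folklore] -/
theorem continuous_tensorAct {n : ℕ} :
    Continuous fun p : Matrix σ σ ℂ × ((Fin n → σ) → ℂ) => tensorAct p.1 p.2 := by
  refine continuous_pi fun j => ?_
  simp only [tensorAct_apply]
  refine continuous_finsetSum _ fun i _ => ?_
  refine Continuous.mul ?_ ?_
  · refine continuous_finsetProd _ fun k _ => ?_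
    exact ((continuous_apply (i k)).comp ((continuous_apply (j k)).comp continuous_fst))
  · exact (continuous_apply i).comp continuous_snd

end Action

/-! ### The polynomial shadow of a tensor -/

section Poly

variable {σ : Type*} [Fintype σ] {R : Type*} [CommRing R] {n : ℕ}

/-- The content (multiset of values, as a finitely supported function) of an index word
`j : Fin n → σ`: `tcontent j = ∑ k, single (j k) 1`. [folklore] -/
def tcontent (j : Fin n → σ) : σ →₀ ℕ := ∑ k, Finsupp.single (j k) 1

omit [Fintype σ] in
/-- The content of a word of length `n` has degree `n`. [folklore] -/
theorem degree_tcontent (j : Fin n → σ) : (tcontent j).degree = n := by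
  unfold tcontent
  rw [map_sum]
  simp [Finsupp.degree_single]

omit [Fintype σ] in
/-- The monomial of a word is the monomial of its content: `∏ k, X (j k) = X^(tcontent j)`.
[folklore] -/
theorem prod_X_eq_monomial_tcontent (j : Fin n → σ) :
    (∏ k, X (j k) : MvPolynomial σ R) = monomial (tcontent j) 1 := by
  unfold tcontent
  rw [monomial_sum_one]
  rfl

/-- The polynomial shadow of an `n`-tensor: `tensorToPoly T = ∑ j, T j · ∏ k, X (j k)`, a form of
degree `n` (for symmetric `T` this is the classical identification `Sym^n ↪ ⊗^n`).
Landsberg 2017 §2.1. [folklore] -/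
def tensorToPoly (T : (Fin n → σ) → R) : MvPolynomial σ R :=
  ∑ j : Fin n → σ, C (T j) * ∏ k, X (j k)

/-- Unfolding `tensorToPoly`. [folklore] -/
theorem tensorToPoly_apply (T : (Fin n → σ) → R) :
    tensorToPoly T = ∑ j : Fin n → σ, C (T j) * ∏ k, X (j k) := rfl

/-- `tensorToPoly` as a sum of monomials. [folklore] -/
theorem tensorToPoly_eq_sum_monomial (T : (Fin n → σ) → R) :
    tensorToPoly T = ∑ j : Fin n → σ, monomial (tcontent j) (T j) := by
  rw [tensorToPoly_apply]
  refine Finset.sum_congr rfl fun j _ => ?_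
  rw [prod_X_eq_monomial_tcontent, C_mul_monomial, mul_one]

/-- The coefficients of the polynomial shadow: `coeff d (tensorToPoly T)` is the sum of `T j`
over the words `j` of content `d`. [folklore] -/
theorem coeff_tensorToPoly [DecidableEq σ] (T : (Fin n → σ) → R) (d : σ →₀ ℕ) :
    coeff d (tensorToPoly T) = ∑ j ∈ Finset.univ.filter (fun j : Fin n → σ => tcontent j = d), T j := by
  rw [tensorToPoly_eq_sum_monomial, coeff_sum, Finset.sum_filter]
  refine Finset.sum_congr rfl fun j _ => ?_
  rw [coeff_monomial]

/-- The polynomial shadow is a form of degree `n`. [folklore] -/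
theorem isHomogeneous_tensorToPoly (T : (Fin n → σ) → R) : (tensorToPoly T).IsHomogeneous n := by
  rw [tensorToPoly_eq_sum_monomial]
  refine IsHomogeneous.sum _ _ _ fun j _ => ?_
  exact isHomogeneous_monomial _ (degree_tcontent j)

/-- `tensorToPoly` is additive. [folklore] -/
theorem tensorToPoly_add (S T : (Fin n → σ) → R) :
    tensorToPoly (S + T) = tensorToPoly S + tensorToPoly T := by
  simp only [tensorToPoly_apply, Pi.add_apply, map_add, add_mul, Finset.sum_add_distrib]

/-- `tensorToPoly` commutes with scalars. [folklore] -/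
theorem tensorToPoly_smul (c : R) (T : (Fin n → σ) → R) :
    tensorToPoly (c • T) = c • tensorToPoly T := by
  simp only [tensorToPoly_apply, Pi.smul_apply, smul_eq_mul, map_mul, Finset.smul_sum, smul_eq_C_mul,
    mul_assoc]

/-- `tensorToPoly` as an `R`-linear map. [folklore] -/
def tensorToPolyLin : ((Fin n → σ) → R) →ₗ[R] MvPolynomial σ R where
  toFun := tensorToPoly
  map_add' := tensorToPoly_add
  map_smul' := tensorToPoly_smul

/-- Unfolding `tensorToPolyLin`. [folklore] -/
@[simp]
theorem tensorToPolyLin_apply (T : (Fin n → σ) → R) : tensorToPolyLin T = tensorToPoly T := rfl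

/-- **Equivariance of the polynomial shadow**: `tensorToPoly (A • T) = A · tensorToPoly T` for the
linear substitution action `X i ↦ ∑ j, A j i • X j` of `LinSubst.lean`. Landsberg 2017 §2.1.
[folklore] -/
theorem tensorToPoly_tensorAct (A : Matrix σ σ R) (T : (Fin n → σ) → R) :
    tensorToPoly (tensorAct A T) = linSubst σ R A (tensorToPoly T) := by
  rw [tensorToPoly_apply, tensorToPoly_apply, map_sum]
  -- expand the right-hand side word by word
  have hR : ∀ i : Fin n → σ, linSubst σ R A (C (T i) * ∏ k, X (i k)) =
      ∑ j : Fin n → σ, C ((∏ k, A (j k) (i k)) * T i) * ∏ k, X (j k) := by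
    intro i
    rw [map_mul, linSubst_C, map_prod]
    simp only [linSubst_X]
    rw [Fintype.prod_sum (fun k y => A y (i k) • (X y : MvPolynomial σ R))]
    rw [Finset.mul_sum]
    refine Finset.sum_congr rfl fun j _ => ?_
    have : (∏ k, A (j k) (i k) • (X (j k) : MvPolynomial σ R)) =
        C (∏ k, A (j k) (i k)) * ∏ k, X (j k) := by
      rw [← smul_eq_C_mul, ← Finset.prod_smul]  -- scalar products
    rw [this, ← mul_assoc, ← map_mul]
    congr 2
    ring
  simp_rw [hR]
  rw [Finset.sum_comm]
  refine Finset.sum_congr rfl fun j _ => ?_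
  rw [tensorAct_apply, map_sum, Finset.sum_mul]

end Poly

/-! ### Norms over `ℂ` -/

section Norm

variable {σ : Type*} [Fintype σ] {n : ℕ}

/-- The squared Hermitian norm of a complex `n`-tensor, `∑ j, ‖T j‖ ^ 2` (the `U(σ)^{⊗ n}`-invariant
norm of Kempf–Ness 1979, §1). [folklore] -/
def tnormSq (T : (Fin n → σ) → ℂ) : ℝ := ∑ j, ‖T j‖ ^ 2

/-- Unfolding `tnormSq`. [folklore] -/
theorem tnormSq_apply (T : (Fin n → σ) → ℂ) : tnormSq T = ∑ j, ‖T j‖ ^ 2 := rfl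

/-- `tnormSq T ≥ 0`. [folklore] -/
theorem tnormSq_nonneg (T : (Fin n → σ) → ℂ) : 0 ≤ tnormSq T :=
  Finset.sum_nonneg fun _ _ => by positivity

/-- `tnormSq` as a complex number is `∑ j, conj (T j) * T j`. [folklore] -/
theorem ofReal_tnormSq (T : (Fin n → σ) → ℂ) :
    ((tnormSq T : ℝ) : ℂ) = ∑ j, (starRingEnd ℂ) (T j) * T j := by
  rw [tnormSq_apply, Complex.ofReal_sum]
  refine Finset.sum_congr rfl fun j _ => ?_
  rw [Complex.conj_mul', Complex.ofReal_pow]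

/-- Column orthonormality of a matrix with `Aᴴ * A = 1`, entrywise. [folklore] -/
theorem sum_conj_mul_eq_of_conjTranspose_mul_self [DecidableEq σ] {A : Matrix σ σ ℂ} (hA : Aᴴ * A = 1)
    (p q : σ) : (∑ x, (starRingEnd ℂ) (A x p) * A x q) = if p = q then 1 else 0 := by
  have h := congr_fun (congr_fun hA p) q
  rw [Matrix.mul_apply, Matrix.one_apply] at h
  simpa [Matrix.conjTranspose_apply] using h

/-- **Unitary invariance of the tensor norm**: if `Aᴴ * A = 1` then `‖A • T‖² = ‖T‖²`
(the tensor power of a unitary matrix is unitary). Kempf–Ness 1979 §1. [folklore] -/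
theorem tnormSq_tensorAct_of_conjTranspose_mul_self [DecidableEq σ] {A : Matrix σ σ ℂ} (hA : Aᴴ * A = 1)
    (T : (Fin n → σ) → ℂ) : tnormSq (tensorAct A T) = tnormSq T := by
  apply Complex.ofReal_injective
  rw [ofReal_tnormSq, ofReal_tnormSq]
  -- expand both tensor entries and exchange sums
  have hexp : ∀ j : Fin n → σ, (starRingEnd ℂ) (tensorAct A T j) * tensorAct A T j =
      ∑ i : Fin n → σ, ∑ i' : Fin n → σ,
        ((∏ k, (starRingEnd ℂ) (A (j k) (i k)) * A (j k) (i' k)) *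
          ((starRingEnd ℂ) (T i) * T i')) := by
    intro j
    rw [tensorAct_apply, map_sum, Finset.sum_mul]
    refine Finset.sum_congr rfl fun i _ => ?_
    rw [Finset.mul_sum]
    refine Finset.sum_congr rfl fun i' _ => ?_
    rw [map_mul, map_prod, Finset.prod_mul_distrib]
    ring
  simp_rw [hexp]
  rw [Finset.sum_comm]
  -- for fixed `i`, sum over `j` first
  have hinner : ∀ i i' : Fin n → σ,
      (∑ j : Fin n → σ, ∏ k, (starRingEnd ℂ) (A (j k) (i k)) * A (j k) (i' k)) =
        if i = i' then 1 else 0 := by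
    intro i i'
    rw [← Fintype.prod_sum (fun k y => (starRingEnd ℂ) (A y (i k)) * A y (i' k))]
    simp_rw [sum_conj_mul_eq_of_conjTranspose_mul_self hA]
    rw [Finset.prod_boole]
    by_cases h : i = i'
    · subst h; simp
    · rw [if_neg, if_neg h]
      intro hall
      exact h (funext fun k => hall k (Finset.mem_univ k))
  refine Finset.sum_congr rfl fun i _ => ?_
  rw [Finset.sum_comm]
  simp_rw [← Finset.sum_mul, hinner]
  simp

/-- `tnormSq` is continuous. [folklore] -/
theorem continuous_tnormSq : Continuous (tnormSq : ((Fin n → σ) → ℂ) → ℝ) := by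
  unfold tnormSq
  refine continuous_finsetSum _ fun j _ => ?_
  exact ((continuous_apply j).norm).pow 2

/-- `tnormSq T = 0 ↔ T = 0`. [folklore] -/
theorem tnormSq_eq_zero_iff (T : (Fin n → σ) → ℂ) : tnormSq T = 0 ↔ T = 0 := by
  rw [tnormSq_apply, Finset.sum_eq_zero_iff_of_nonneg fun _ _ => by positivity]
  constructor
  · intro h
    funext j
    have := h j (Finset.mem_univ j)
    simpa using this
  · intro h j _
    simp [h]

/-- The tensor of a diagonal scaling has norm `∑ j, (∏ k, ‖d (j k)‖) ^ 2 * ‖T j‖ ^ 2`.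
[folklore] -/
theorem tnormSq_tensorAct_diagonal [DecidableEq σ] (d : σ → ℂ) (T : (Fin n → σ) → ℂ) :
    tnormSq (tensorAct (Matrix.diagonal d) T) = ∑ j, (∏ k, ‖d (j k)‖) ^ 2 * ‖T j‖ ^ 2 := by
  rw [tensorAct_diagonal, tnormSq_apply]
  refine Finset.sum_congr rfl fun j _ => ?_
  rw [norm_mul, norm_prod, mul_pow]

end Norm

end Literature.Computability.AlgebraicComplexity
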